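import Summits.CriticalPhenomena.PercolationContinuityZ3.Theorems.Transplant.PlanarCellsDefs
import HarnessLib

/-!
# Kozma–Nitzan's planar cells in `ℤ²`, part 2: disjointness of cubes / between-boxes / far regions / cells / zones, the column facts, and
# self-adjacency (the planar halves of p2-g2's `SepGeom`, `ExitGeom`, `RunGeom` for the `X □ ℤ²` instance; BLUEPRINT-I-PHI §1 row "cells")

builds on p205010 (kernel theorem, internal audit signed; external expert review pending) — nothing in this file uses p205010.
Lane `prim-bschramm`, seat `prim-bschramm-p3`; helper file (`--supports stmt-CriticalPhenomena-4575 --as helper`).  Continues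
`PlanarCellsDefs` (definitions, membership, one-dimensional comparisons, containments).

* `Q_disjoint_Q`, `Q_disjoint_Btw`, `Q_disjoint_Efar`, `Btw_disjoint_Efar`, `Ewv_disjoint_Efar`, `Btw_disjoint_Btw`, `Cell_disjoint_Q`,
  `Zone_disjoint_Q` — all by the one-dimensional comparisons `oneD_*` along a planar axis;
* the column facts `cen_not_mem_Cell`, `cen_not_mem_Zone` (KN (29): the marker of `x` is met only inside `Q_x`);
* self-adjacency `exists_adj_of_mem_Q / _Btw / _Stub` (every vertex of a box has a `ℤ²`-neighbour in it) and `Stub_mono`.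

[cite: KozmaNitzan2024, §4 pp. 25–26 (Q_v, M_v, E_{v,x}, H^j_{v,x}) — the ℤ^d model]
-/

noncomputable section

namespace Summit.CriticalPhenomena.PercolationContinuityZ3.Theorems

namespace Transplant

open Literature.Probability.Percolation Literature.Probability.LatticeModels SimpleGraph GadgetSystem Contour
open Literature.Probability.Percolation.KozmaNitzan
open Literature.Probability.Percolation.KozmaNitzan.Cells (oth oth_ne sgOf sgOf_sign stepVec_apply_fst stepVec_apply_oth eq_oth_of_ne oth_oth
  eq_of_coords)

namespace PCells

variable (C : PCells)

/-! ## Disjointness -/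

/-- Distinct macro-vertices have disjoint cubes. [folklore] -/
theorem Q_disjoint_Q {u x : Site 2} (h : u ≠ x) : Disjoint (C.Q u : Finset (Site 2)) (C.Q x) := by
  rw [Finset.disjoint_left]
  intro t htu htx
  rw [Q, C.mem_sq_iff] at htu htx
  apply h
  funext i
  have h1 := htu i; have h2 := htx i
  push_cast at h1 h2
  have hr : (1 : ℤ) ≤ C.r := by exact_mod_cast C.one_le_r
  exact oneD_sq_sq hr (w := 5 * C.r) (w' := 5 * C.r) (by omega) (by simpa using h1) (by simpa using h2)

/-- Cubes and between-boxes are disjoint. [folklore] -/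
theorem Q_disjoint_Btw (x v : Site 2) (δ : MDir) : Disjoint (C.Q x : Finset (Site 2)) (C.Btw v δ) := by
  rw [Finset.disjoint_left]
  intro t htQ htB
  rw [Q, C.mem_sq_iff] at htQ
  rw [Btw, mem_psBox_iff] at htB
  obtain ⟨⟨h1, h2⟩, -, -⟩ := htB
  have ha := htQ δ.1
  push_cast at ha h1 h2
  have hr : (1 : ℤ) ≤ C.r := by exact_mod_cast C.one_le_r
  exact oneD_sq_btw hr (sgOf_sign δ) (m := x δ.1) (n := v δ.1) (by simpa using ha) (by simpa using And.intro h1 h2)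

/-- A cube misses the far region of its own macro-vertex. [folklore] -/
theorem Q_disjoint_Efar (v : Site 2) (δ : MDir) : Disjoint (C.Q v : Finset (Site 2)) (C.Efar v δ) := by
  rw [Finset.disjoint_left]
  intro t htQ htE
  rw [Q, C.mem_sq_iff] at htQ
  rw [Efar, mem_psBox_iff] at htE
  obtain ⟨⟨h1, -⟩, -, -⟩ := htE
  have ha := htQ δ.1
  push_cast at ha h1
  rcases sgOf_sign δ with hs | hs <;> rw [hs] at h1 <;> omega

/-- Between-boxes of different directions at the same macro-vertex miss each other's far regions. [folklore] -/
theorem Btw_disjoint_Efar (v : Site 2) {δ δ' : MDir} (h : δ' ≠ δ) : Disjoint (C.Btw v δ') (C.Efar v δ) := by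
  rw [Finset.disjoint_left]
  intro t htB htE
  rw [Btw, mem_psBox_iff] at htB
  rw [Efar, mem_psBox_iff] at htE
  obtain ⟨⟨hb1, hb2⟩, hb3, hb4⟩ := htB
  obtain ⟨⟨he1, he2⟩, he3, he4⟩ := htE
  by_cases hax : δ'.1 = δ.1
  · -- same axis, opposite signs
    have hsg : sgOf δ' = -sgOf δ := by
      have hne : δ'.2 ≠ δ.2 := fun h2 => h (Prod.ext hax h2)
      unfold sgOf; rcases Bool.eq_false_or_eq_true δ.2 with hb | hb <;> simp_all
    rw [hax, hsg] at hb1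
    rcases sgOf_sign δ with hs | hs <;> rw [hs] at hb1 he1 <;> omega
  · -- different axes: the transverse coordinate of `Btw v δ'` is the axis of `Efar v δ`
    have hoth : δ.1 = oth δ'.1 := eq_oth_of_ne (Ne.symm hax)
    rw [← hoth] at hb3 hb4
    rcases sgOf_sign δ with hs | hs <;> rw [hs] at he1 <;> omega

/-- `E_{w,δw} = Btw ∪ Q_{w+δw}` misses the far regions of `w + δw` in every direction except back. [folklore] -/
theorem Ewv_disjoint_Efar (w : Site 2) {δw du : MDir} (h : du ≠ rev δw) :
    Disjoint (C.Ewv w δw) (C.Efar (w + stepVec δw) du) := by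
  rw [Ewv, Finset.disjoint_union_left]
  refine ⟨?_, C.Q_disjoint_Efar _ du⟩
  rw [Finset.disjoint_left]
  intro t htB htE
  rw [Btw, mem_psBox_iff] at htB
  rw [Efar, mem_psBox_iff] at htE
  obtain ⟨⟨hb1, hb2⟩, hb3, hb4⟩ := htB
  obtain ⟨⟨he1, he2⟩, he3, he4⟩ := htE
  have hf := C.cen_add_stepVec_fst w δw
  have ho := C.cen_add_stepVec_oth w δw
  by_cases hax : du.1 = δw.1
  · -- same axis: `du = δw` (not the reverse), so `Efar` points further out while `Btw` is behind `Q_{w+δw}`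
    have hsg : sgOf du = sgOf δw := by
      have h2 : du.2 = δw.2 := by
        by_contra hne
        apply h
        refine Prod.ext hax ?_
        change du.2 = !δw.2
        rcases Bool.eq_false_or_eq_true δw.2 with hb | hb <;> rcases Bool.eq_false_or_eq_true du.2 with hb' | hb' <;> simp_all
      unfold sgOf; rw [h2]
    rw [hax, hsg, hf] at he1
    rcases sgOf_sign δw with hs | hs <;> rw [hs] at hb2 he1 <;> nlinarith
  · have hoth : du.1 = oth δw.1 := eq_oth_of_ne hax
    rw [hoth, ho] at he1
    rcases sgOf_sign du with hs | hs <;> rw [hs] at he1 <;> omega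

/-- Between-boxes of different (undirected) macro-edges are disjoint. [folklore] -/
theorem Btw_disjoint_Btw {v v' : Site 2} {δ δ' : MDir} (h1 : (v', δ') ≠ (v, δ)) (h2 : (v', δ') ≠ (v + stepVec δ, rev δ)) :
    Disjoint (C.Btw v δ : Finset (Site 2)) (C.Btw v' δ') := by
  rw [Finset.disjoint_left]
  intro t ht ht'
  rw [Btw, mem_psBox_iff] at ht ht'
  obtain ⟨⟨ha1, ha2⟩, ha3, ha4⟩ := ht
  obtain ⟨⟨hb1, hb2⟩, hb3, hb4⟩ := ht'
  have hr : (1 : ℤ) ≤ C.r := by exact_mod_cast C.one_le_r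
  by_cases hax : δ'.1 = δ.1
  · -- same axis: transverse coordinates force `v' (oth) = v (oth)`; along the axis the strips must coincide
    rw [hax] at hb1 hb2 hb3 hb4
    have hoth : v' (oth δ.1) = v (oth δ.1) := by
      exact oneD_sq_sq hr (w := 5 * C.r) (w' := 5 * C.r) (by omega) (by simpa using And.intro hb3 hb4) (by simpa using And.intro ha3 ha4)
    rcases oneD_btw_btw hr (sgOf_sign δ) (sgOf_sign δ') (n := v δ.1) (n' := v' δ.1) (t := t δ.1)
        (by simpa using And.intro ha1 ha2) (by simpa using And.intro hb1 hb2) with ⟨hn, hs⟩ | ⟨hn, hs⟩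
    · apply h1
      have hδ : δ' = δ := by
        refine Prod.ext hax ?_
        have := hs; unfold sgOf at this
        rcases Bool.eq_false_or_eq_true δ.2 with hb | hb <;> rcases Bool.eq_false_or_eq_true δ'.2 with hb' | hb' <;> simp_all
      exact Prod.ext (eq_of_coords δ.1 hn.symm hoth) hδ
    · apply h2
      have hδ : δ' = rev δ := by
        refine Prod.ext hax ?_
        change δ'.2 = !δ.2
        have := hs; unfold sgOf at this
        rcases Bool.eq_false_or_eq_true δ.2 with hb | hb <;> rcases Bool.eq_false_or_eq_true δ'.2 with hb' | hb' <;> simp_all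
      refine Prod.ext (eq_of_coords δ.1 ?_ ?_) hδ
      · change v' δ.1 = (v + stepVec δ) δ.1
        rw [Pi.add_apply, stepVec_apply_fst]; exact hn
      · change v' (oth δ.1) = (v + stepVec δ) (oth δ.1)
        rw [Pi.add_apply, stepVec_apply_oth, add_zero]; exact hoth
  · -- different axes: the transverse coordinate of one is the axis of the other
    have hoth : δ'.1 = oth δ.1 := eq_oth_of_ne hax
    have hoth' : δ.1 = oth δ'.1 := eq_oth_of_ne (Ne.symm hax)
    rw [← hoth] at ha3 ha4
    exact oneD_sq_btw hr (sgOf_sign δ') (m := v δ'.1) (n := v' δ'.1) (by simpa using And.intro ha3 ha4) (by simpa using And.intro hb1 hb2)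

/-- Cells miss the cubes of other macro-vertices. [folklore] -/
theorem Cell_disjoint_Q {u x : Site 2} (h : u ≠ x) : Disjoint (C.Cell u) (C.Q x) := by
  rw [Finset.disjoint_left]
  intro t htC htQ
  rw [Cell, C.mem_sq_iff] at htC
  rw [Q, C.mem_sq_iff] at htQ
  apply h
  funext i
  have h1 := htC i; have h2 := htQ i
  push_cast at h1 h2
  have hr : (1 : ℤ) ≤ C.r := by exact_mod_cast C.one_le_r
  exact oneD_sq_sq hr (w := 10 * C.r) (w' := 5 * C.r) (by omega) (by simpa using h1) (by simpa using h2)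

/-- Stub zones miss all cubes. [folklore] -/
theorem Zone_disjoint_Q (u : Site 2) (δ : MDir) (x : Site 2) : Disjoint (C.Zone u δ) (C.Q x) := by
  rw [Finset.disjoint_left]
  intro t htZ htQ
  rw [Zone, mem_psBox_iff] at htZ
  rw [Q, C.mem_sq_iff] at htQ
  obtain ⟨⟨h1, h2⟩, -, -⟩ := htZ
  obtain ⟨ha1, ha2⟩ := htQ δ.1
  have hs20 : 20 * (C.s : ℤ) ≤ C.r := by exact_mod_cast C.twenty_mul_s_le_r
  have hs1 : (1 : ℤ) ≤ C.s := by exact_mod_cast C.hs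
  push_cast at ha1 ha2 h1 h2
  rcases lt_trichotomy (x δ.1) (u δ.1) with hlt | heq | hgt
  · have hg := C.cen_gap (u := x) (v := u) (i := δ.1) (by omega)
    rcases sgOf_sign δ with hs | hs <;> rw [hs] at h1 h2 <;> omega
  · have hg := C.cen_congr (u := x) (v := u) (i := δ.1) heq
    rcases sgOf_sign δ with hs | hs <;> rw [hs] at h1 h2 <;> omega
  · have hg := C.cen_gap (u := u) (v := x) (i := δ.1) (by omega)
    rcases sgOf_sign δ with hs | hs <;> rw [hs] at h1 h2 <;> omega

/-! ## The column of a macro-vertex: its centre -/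

/-- The centre of `x` is not in the cell of another macro-vertex. [folklore] -/
theorem cen_not_mem_Cell {u x : Site 2} (h : u ≠ x) : C.cen x ∉ C.Cell u := fun hc =>
  Finset.disjoint_left.1 (C.Cell_disjoint_Q h) hc (C.cen_mem_Q x)

/-- The centre of `x` is in no stub zone. [folklore] -/
theorem cen_not_mem_Zone (u : Site 2) (δ : MDir) (x : Site 2) : C.cen x ∉ (C.Zone u δ : Finset (Site 2)) := fun hz =>
  Finset.disjoint_left.1 (C.Zone_disjoint_Q u δ x) hz (C.cen_mem_Q x)

/-! ## Self-adjacency: every vertex of a box has a lattice neighbour in the box -/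

/-- In an integer box `Icc lo hi` with `lo i + 1 ≤ hi i` for some `i`, every vertex has a `ℤ²`-neighbour inside. [folklore] -/
theorem exists_adj_of_mem_Icc {lo hi : Site 2} (i : Fin 2) (hw : lo i + 1 ≤ hi i) {t : Site 2} (ht : t ∈ Finset.Icc lo hi) :
    ∃ t' ∈ Finset.Icc lo hi, (zdGraph 2).Adj t t' := by
  rw [mem_Icc_iff] at ht
  by_cases h : t i + 1 ≤ hi i
  · refine ⟨t + stepVec (i, true), ?_, ?_⟩
    · rw [mem_Icc_iff]; intro k
      rcases eq_or_ne k i with rfl | hk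
      · have := stepVec_apply_fst (k, true); simp only at this
        rw [Pi.add_apply, this]; unfold sgOf; simp only [if_true]; have := ht k; omega
      · have hk' : k = oth i := eq_oth_of_ne hk
        have := stepVec_apply_oth (i, true); simp only at this
        rw [hk', Pi.add_apply, this, add_zero]; exact ht _
    · exact (zdGraph_adj_iff_stepVec t _).2 ⟨(i, true), rfl⟩
  · refine ⟨t + stepVec (i, false), ?_, ?_⟩
    · rw [mem_Icc_iff]; intro k
      rcases eq_or_ne k i with rfl | hk
      · have := stepVec_apply_fst (k, false); simp only at this
        rw [Pi.add_apply, this]; unfold sgOf; simp only [Bool.false_eq_true, if_false]; have := ht k; omega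
      · have hk' : k = oth i := eq_oth_of_ne hk
        have := stepVec_apply_oth (i, false); simp only at this
        rw [hk', Pi.add_apply, this, add_zero]; exact ht _
    · exact (zdGraph_adj_iff_stepVec t _).2 ⟨(i, false), rfl⟩

/-- Self-adjacency of `Q_v`. [folklore] -/
theorem exists_adj_of_mem_Q (v : Site 2) {t : Site 2} (ht : t ∈ C.Q v) : ∃ t' ∈ C.Q v, (zdGraph 2).Adj t t' :=
  exists_adj_of_mem_Icc 0 (by simp only [Pi.sub_apply, Pi.add_apply, Pi.natCast_apply]; push_cast; have := C.one_le_r; omega) ht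

/-- Self-adjacency of `Btw` (a signed box is an `Icc`; its transverse side has length `10r ≥ 1`). [folklore] -/
theorem exists_adj_of_mem_Btw (v : Site 2) (δ : MDir) {t : Site 2} (ht : t ∈ C.Btw v δ) : ∃ t' ∈ C.Btw v δ, (zdGraph 2).Adj t t' := by
  unfold Btw sBox at ht ⊢
  refine exists_adj_of_mem_Icc (oth δ.1) ?_ ht
  simp only [sLo, sHi, if_neg (oth_ne δ.1)]
  have := C.one_le_r; omega

/-- Self-adjacency of the stubs. [folklore] -/
theorem exists_adj_of_mem_Stub (v : Site 2) (δ : MDir) (j : ℕ) {t : Site 2} (ht : t ∈ C.Stub v δ j) :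
    ∃ t' ∈ C.Stub v δ j, (zdGraph 2).Adj t t' := by
  unfold Stub sBox at ht ⊢
  refine exists_adj_of_mem_Icc (oth δ.1) ?_ ht
  simp only [sLo, sHi, if_neg (oth_ne δ.1)]
  have := C.one_le_r; omega

/-- The stubs grow with the level. [folklore] -/
theorem Stub_mono (v : Site 2) (δ : MDir) {j j' : ℕ} (h : j ≤ j') : (C.Stub v δ j : Finset (Site 2)) ⊆ C.Stub v δ j' := by
  intro t ht
  rw [Stub, mem_psBox_iff] at ht ⊢
  obtain ⟨⟨h1, h2⟩, h3, h4⟩ := ht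
  have : 10 * (C.s : ℤ) * j ≤ 10 * C.s * j' := by
    have : (j : ℤ) ≤ j' := by exact_mod_cast h
    nlinarith
  exact ⟨⟨h1, by omega⟩, h3, h4⟩

end PCells

end Transplant

end Summit.CriticalPhenomena.PercolationContinuityZ3.Theorems

end
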